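import Summits.AtomisticToContinuum.HydrodynamicLimit.Theorems.EquilibriumFastWindowLD.Negative.BetaCeiling

/-!
# `EquilibriumFastWindowLD` — negative knowledge (c.2): NO tilt range uniform in the observable

Support file for crux `stmt-AtomisticToContinuum-14440` (`TwoClocks.EquilibriumFastWindowLD`), written by the
standing disprover (cdisprove seat). `EquilibriumFastWindowLDUniformBeta` is the natural strengthening of the crux in
which the tilt range is chosen BEFORE the observable (`∃ β₀ > 0, ∀ F admissible, ∀ |β| ≤ β₀ …` instead of
`∀ F, ∃ β₀, ∀ |β| ≤ β₀ …`; all other tokens verbatim). It is FALSE, unconditionally: given `β₀`, the admissible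
`F_A` of `Negative/BetaCeiling.lean` with `A = 1/(2β₀)` has window exponential moment `+∞` at `β = β₀` for every
window, flow and `N` (`windowMoment_FA_eq_top`), so no `τ, N₀` can serve at `ε = 1`. Hence in the crux `β₀ = β₀(F)`
genuinely, with `β₀(F) ≲ 1/C_F` (`two_mul_beta_mul_lt_one_of_windowMoment_ne_top`).
-/

noncomputable section

open MeasureTheory ProbabilityTheory Real Set
open scoped ENNReal

namespace Summit.AtomisticToContinuum.HydrodynamicLimit.Theorems.EquilibriumFastWindowLDNegative

open Literature.Analysis.FluidPDE Literature.MathematicalPhysics.KineticTheory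
open Summit.AtomisticToContinuum.HydrodynamicLimit.Theorems.CorrectorPressureDecayNegative

/-- `TwoClocks.EquilibriumFastWindowLD` with `∃ β₀ > 0` moved in front of `∀ F` (tilt range uniform over the
admissible observables); all other tokens verbatim. A variant statement refuted below, not a fact. -/
def EquilibriumFastWindowLDUniformBeta : Prop :=
  ∃ σ₀ : ℝ, 0 < σ₀ ∧ ∀ (a₀ θ₀ : ℝ) (u₀ : V3), 0 < a₀ → 0 < θ₀ → ∀ σ : ℝ, 0 < σ → σ < σ₀ →
    ∀ Φ : (N : ℕ) → HardSphereFlow (Torus.geometry (Fin 3)) (hsDiameter σ N) (N + 1),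
    ∃ β₀ : ℝ, 0 < β₀ ∧ ∀ F : T3 × V3 → ℝ, Continuous F → (∃ C : ℝ, ∀ y, |F y| ≤ C * (1 + ‖y.2‖ ^ 2)) →
    (∀ x, ∫ v, F (x, v) * localMaxwellian 1 θ₀ u₀ v = 0) →
    (∀ x (j : Fin 3), ∫ v, F (x, v) * v j * localMaxwellian 1 θ₀ u₀ v = 0) →
    (∀ x, ∫ v, F (x, v) * ‖v‖ ^ 2 * localMaxwellian 1 θ₀ u₀ v = 0) →
    ∀ β : ℝ, |β| ≤ β₀ → ∀ ε : ℝ, 0 < ε → ∃ τ : ℝ, 0 < τ ∧ ∃ N₀ : ℕ,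
      ∀ N : ℕ, N₀ ≤ N →
        ∫⁻ z, ENNReal.ofReal (Real.exp (β * ∑ i : Fin (N + 1),
            (τ * ((N : ℝ) + 1) ^ (-(1 / 3 : ℝ)))⁻¹ *
              ∫ r in (0 : ℝ)..(τ * ((N : ℝ) + 1) ^ (-(1 / 3 : ℝ))), F (((Φ N).flow r z) i)))
          ∂(localGibbsLaw σ (fun _ => a₀) (fun _ => u₀) (fun _ => θ₀) N (Φ N)) ≤
        ENNReal.ofReal (Real.exp (ε * ((N : ℝ) + 1)))

/-- **(c.2) The tilt range cannot be chosen uniformly in `F`.** [folklore] -/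
theorem equilibriumFastWindowLD_false_uniformBeta : ¬ EquilibriumFastWindowLDUniformBeta := by
  rintro ⟨σ₀, hσ₀, h⟩
  set σ : ℝ := min (σ₀ / 2) (1 / 4) with hσdef
  have hσpos : 0 < σ := lt_min (by linarith) (by norm_num)
  have hσlt : σ < σ₀ := (min_le_left _ _).trans_lt (by linarith)
  have hσ2 : σ ≤ 1 / 2 := (min_le_right _ _).trans (by norm_num)
  have hσhalf : σ < 2⁻¹ := (min_le_right _ _).trans_lt (by norm_num)
  set Φ : (N : ℕ) → HardSphereFlow (Torus.geometry (Fin 3)) (hsDiameter σ N) (N + 1) :=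
    fun N => Classical.choice (nonempty_flow hσpos hσhalf N) with hΦdef
  obtain ⟨β₀, hβ₀, hβ⟩ := h 1 1 0 one_pos one_pos σ hσpos hσlt Φ
  -- the admissible witness `F_A`, `A = 1/(2β₀)`
  set A : ℝ := (2 * β₀)⁻¹ with hAdef
  have hA : 0 < A := by rw [hAdef]; positivity
  have hβA : 1 ≤ 2 * (β₀ * A) := by
    rw [hAdef, ← mul_assoc, mul_inv_cancel₀ (by positivity : (2 : ℝ) * β₀ ≠ 0)]
  set F : T3 × V3 → ℝ := fun y =>
    A * (‖y.2‖ ^ 2 - 15 + 12 * Real.sqrt 2 * Real.exp (-(1 / 2) * (y.2 0) ^ 2)) with hFdef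
  have hFc : Continuous F := by rw [hFdef]; fun_prop
  have hFg : ∃ C : ℝ, ∀ y, |F y| ≤ C * (1 + ‖y.2‖ ^ 2) :=
    ⟨(15 + 12 * Real.sqrt 2) * A, fun y => by rw [hFdef]; exact abs_FA_le hA.le y.2⟩
  have hF1 : ∀ x : T3, ∫ v, F (x, v) * localMaxwellian 1 1 (0 : V3) v = 0 := fun x => by
    simp only [hFdef]; exact integral_FA_mul_localMaxwellian A
  have hFv : ∀ (x : T3) (j : Fin 3), ∫ v, F (x, v) * v j * localMaxwellian 1 1 (0 : V3) v = 0 := fun x j => by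
    simp only [hFdef]; exact integral_FA_mul_coord_mul_localMaxwellian A j
  have hFE : ∀ x : T3, ∫ v, F (x, v) * ‖v‖ ^ 2 * localMaxwellian 1 1 (0 : V3) v = 0 := fun x => by
    simp only [hFdef]; exact integral_FA_mul_normSq_mul_localMaxwellian A
  obtain ⟨τ, hτ, N₀, hN⟩ := hβ F hFc hFg hF1 hFv hFE β₀ (abs_of_pos hβ₀).le 1 one_pos
  have hw : 0 < τ * ((N₀ : ℝ) + 1) ^ (-(1 / 3 : ℝ)) := mul_pos hτ (Real.rpow_pos_of_pos (by positivity) _)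
  have h0 := hN N₀ le_rfl
  simp only [hFdef] at h0
  rw [windowMoment_FA_eq_top one_pos hσ2 N₀ (Φ N₀) hA hβ₀ hβA hw, top_le_iff] at h0
  exact ENNReal.ofReal_ne_top h0

end Summit.AtomisticToContinuum.HydrodynamicLimit.Theorems.EquilibriumFastWindowLDNegative

end
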